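import Literature.Probability.RandomPlanarGeometry.SAWPulledLargeForceExpansionZdBridgeSearch
import HarnessLib

/-!
# «ZD-BRIDGE-FAST»: a lean kernel state for the two-level bridge search, its semantics, and a table-driven assembly

Topic `Literature/Probability/RandomPlanarGeometry` (sequel of `…ZdWordSearch` #593 / `…ZdBridgeWords` #622 / `…ZdBridgeSearch` #636).  By
`costCoeffZd_eq_sum_trie` (#636) a cost cell `N_{c,n+1}(ℤ^{d+1})` of the pulled large-force expansion is, in every dimension `d`, the
falling-factorial polynomial of the reduced counts of the two-level search (vertical pattern in a certified trie, endpoint new), whose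
pruning test `okT` reads the REVERSED RAW PREFIX (cost per search node: a walk back along the prefix with a displacement list, and a trie
walk from the root).  This file replaces that state by a LEAN one with the same meaning, so that the kernel evaluates a cell some thirty
times faster (measured: the whole cell `N_{9,12}`, 28 860 live nodes, in ≈ 7 s as ONE evaluation — §5), and the cost-ten cells
`N_{10,11}`, `N_{10,12}`, `N_{10,13}` (1.9 / 3.9 / 0.4 million live nodes) come within reach:

* KERNEL SIDE (§1): the state = (trie NODE of the pattern so far — descended, not re-walked; KEY of the endpoint = base-`32` digits
  `16 + coordinate` over the word axes; BITMASK of the `4093`-slots and LIST of the keys of the earlier points — membership is one `Nat.land`,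
  the exact scan runs only on a slot hit); the evaluator ★ `fastV` / `fastS` (children spelled out: vertical `±`, old transverse axes both
  signs — skipped wholesale below a dead transverse child —, the new axis positive), all arithmetic on kernel-accelerated `Nat` operations;
* §2 ★ `fastS_eq_dfsV`: the evaluator IS the generic census `dfsV` (#593) of the lean machine (`updF`, `okF`, `clsF`, start `s0F`);
* SEMANTICS (§3): along a canonical word the lean state is (node of the vertical pattern, key of the endpoint, mask and keys of the earlier
  points) (★★ `st_updF_take`: the key arithmetic is exact — `encS_add_twoStepV` — and injective on the box of reachable points —
  `encS_injective_of_bounds` —, the mask never hides a listed key — `memM_maskOf`), hence ★★★ `okF_st_eq_okT`: its pruning test EQUALS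
  `okT` at every prefix, ★★★ `dfsN_fast_eq`: the lean counts are the two-level counts, and ★★★ `costCoeffZd_eq_sum_fast` /
  `costCoeffZd_eq_sum_of_fastS`: **a cost cell in every dimension from ONE lean census value** (words over `≤ 15` axes);
* ASSEMBLY BY TABLE (§4): a large cell is evaluated as many sub-cells `fastS B j (st updF s₀ w) m = Nat.ofDigits B digits`; the
  table-driven evaluator ★ `fastVT` re-runs only the top of the search reading those values, and ★★ `fastVT_eq` / ★★★ `fastS_root_eq_fastVT`:
  with a TRUE table the table-driven root value is the census value (`table_ok_of` splits the hypothesis into a decidable shape check and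
  the cell theorems) — no per-node rewriting scripts;
* §5 SELF-TEST: on the certified trie `tr9_12` of #636 the lean engine returns the landed table of `…ZdBridgeNineTwelve`
  (★ `fastS_tr9_12_root`, `costCoeffZd_nine_twelve_eq_sum_fast`).
[cite: MadrasSlade1993, Definition 1.2.4; §4.2, eq. (4.2.20)–(4.2.22) (p. 94, 2013 reprint)]
The definitions `desc`, `alive`, `memN`, `slot`, `memM`, `newKey`, `sumTo`, `fastV`, `FS`, `updF`, `okF`, `clsF`, `key0`, `s0F`, `fastS`, `tdesc`,
`dg`, `encS`, `keyW`, `visW`, `maskOf`, `lookupT`, `fastVT` are this file's tool notions (not notions in print).  No number is taken from print.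

Provenance: lane «pcv-sawmu», a-p3 g22 (2026-08-27).
-/

open Finset
open scoped BigOperators
open Literature.Probability.LatticeModels
open Literature.Probability.RandomPlanarGeometry.SAW

namespace Literature.Probability.RandomPlanarGeometry.SAW.Zd

namespace WordTypes

/-! ### §1 Kernel side: the lean state and the evaluator -/

section kernelside

/-- Descend one vertical letter (`0` up, `1` down, `2` transverse) in a pattern trie; dead and accepting nodes are absorbing.
[cite: MadrasSlade1993, Definition 1.2.4] -/
def desc : Tri → ℕ → Tri
  | Tri.no, _ => Tri.no
  | Tri.yes, _ => Tri.yes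
  | Tri.br u d t, x => if x == 0 then u else if x == 1 then d else t

/-- A trie node is alive (not the dead node). [cite: MadrasSlade1993, Definition 1.2.4] -/
def alive : Tri → Bool
  | Tri.no => false
  | _ => true

/-- Membership of a natural number in a list, by `Nat.beq`. [cite: MadrasSlade1993, Definition 1.2.4] -/
def memN (k : ℕ) : List ℕ → Bool
  | [] => false
  | x :: xs => Nat.beq k x || memN k xs

/-- The bitmask slot of a key: one bit among `4093`. [cite: MadrasSlade1993, Definition 1.2.4] -/
def slot (k : ℕ) : ℕ := 2 ^ (k % 4093)

/-- Membership with a bitmask pre-test: the exact scan `memN` runs only if the key's slot is set in `mask`. [cite: MadrasSlade1993, Definition 1.2.4] -/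
def memM (k mask : ℕ) (vs : List ℕ) : Bool := !(Nat.beq (Nat.land mask (slot k)) 0) && memN k vs

/-- The key of the next lattice point: one step along axis `a.1`, sign `a.2`, in base `32`. [cite: MadrasSlade1993, Definition 1.2.4] -/
def newKey (k : ℕ) (a : ℕ × Bool) : ℕ := bif a.2 then k + 32 ^ a.1 else k - 32 ^ a.1

/-- `sumTo f m = Σ_{i<m} f i`, by structural recursion. [cite: MadrasSlade1993, Definition 1.2.4] -/
def sumTo (f : ℕ → ℕ) : ℕ → ℕ
  | 0 => 0
  | i + 1 => sumTo f i + f i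

/-- ★ THE LEAN EVALUATOR of the reduced two-level bridge search (what the kernel runs): `j` letters to go, trie node `t` (the vertical pattern
so far, descended), key `k` of the endpoint (base-`32` digits `16 + coordinate` over the word axes), bitmask `mask` and list `vs` of the keys
of the earlier points, `m` axes so far; value `Σ B^{m'}` over the admissible completions (`m'` = final number of axes).  Children (policy
`alwR`): axis `0` = the vertical `±` (trie letters `0`/`1`, keys `k ± 1`), old transverse axes `1 ≤ i < m` both signs (trie letter `2`, keys
`k ± 32^i`, skipped wholesale below a dead transverse child), the new axis `m` positive only. [cite: MadrasSlade1993, Definition 1.2.4] -/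
def fastV (B : ℕ) : ℕ → Tri → ℕ → ℕ → List ℕ → ℕ → ℕ
  | 0, t, k, mask, vs, m => bif alive t && !(memM k mask vs) then B ^ m else 0
  | j + 1, t, k, mask, vs, m => bif alive t && !(memM k mask vs) then
      (bif Nat.beq m 0 then 0 else
        (fastV B j (desc t 0) (k + 1) (Nat.lor mask (slot k)) (k :: vs) m +
          fastV B j (desc t 1) (k - 1) (Nat.lor mask (slot k)) (k :: vs) m +
          bif alive (desc t 2) then
            sumTo (fun i => fastV B j (desc t 2) (k + 32 ^ (i + 1)) (Nat.lor mask (slot k)) (k :: vs) m +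
              fastV B j (desc t 2) (k - 32 ^ (i + 1)) (Nat.lor mask (slot k)) (k :: vs) m) (m - 1)
          else 0)) +
        fastV B j (desc t (bif Nat.beq m 0 then 0 else 2)) (k + 32 ^ m) (Nat.lor mask (slot k)) (k :: vs) (m + 1)
    else 0

/-- The lean search state: trie node, endpoint key, bitmask and list of the earlier keys. [cite: MadrasSlade1993, Definition 1.2.4] -/
structure FS where
  /-- the trie node of the vertical pattern so far -/
  node : Tri
  /-- the key of the endpoint -/
  key : ℕ
  /-- the bitmask of the slots of the earlier keys -/
  mask : ℕ
  /-- the earlier keys, most recent first -/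
  vis : List ℕ

/-- State update by one raw letter (vertical letters relative to the first letter `(0, true)` of a canonical word). [cite: MadrasSlade1993, Definition 1.2.4] -/
def updF (s : FS) (a : ℕ × Bool) : FS := ⟨desc s.node (vlet (0, true) a), newKey s.key a, Nat.lor s.mask (slot s.key), s.key :: s.vis⟩

/-- The pruning test of the lean state: pattern alive and endpoint new. [cite: MadrasSlade1993, Definition 1.2.4] -/
def okF (s : FS) : Bool := alive s.node && !(memM s.key s.mask s.vis)

/-- One class: everything that survives. [cite: MadrasSlade1993, Definition 1.2.4] -/
def clsF : ℕ → FS → Bool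
  | 0 => fun _ => true
  | _ => fun _ => false

/-- The key of the origin over `L` axes: all digits `16`. [cite: MadrasSlade1993, Definition 1.2.4] -/
def key0 : ℕ → ℕ
  | 0 => 0
  | L + 1 => 16 + 32 * key0 L

/-- The start state: trie root, origin key, no earlier points. [cite: MadrasSlade1993, Definition 1.2.4] -/
def s0F (tr : Tri) (L : ℕ) : FS := ⟨tr, key0 L, 0, []⟩

/-- The evaluator on a packed state. [cite: MadrasSlade1993, Definition 1.2.4] -/
def fastS (B j : ℕ) (s : FS) (m : ℕ) : ℕ := fastV B j s.node s.key s.mask s.vis m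

end kernelside

/-! ### §2 The evaluator is the generic census `dfsV` of the lean machine -/

section evaluator

/-- `sumTo` is a `Finset.range` sum. [cite: MadrasSlade1993, Definition 1.2.4] -/
theorem sumTo_eq_sum (f : ℕ → ℕ) (m : ℕ) : sumTo f m = ∑ i ∈ Finset.range m, f i := by
  induction m with
  | zero => rfl
  | succ m ih => rw [sumTo, ih, Finset.sum_range_succ]

/-- The reduced letters at axis count `m`: all letters of axis `< m`, then the new axis with the positive sign. [cite: MadrasSlade1993, Definition 1.2.4] -/
theorem lts_alwR_eq (m : ℕ) : lts alwR m = letters m ++ [(m, true)] := by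
  unfold lts letters
  rw [List.range_succ, List.flatMap_append, List.filter_append]
  congr 1
  · rw [List.filter_eq_self]
    intro a ha
    simp only [List.mem_flatMap, List.mem_range, List.mem_cons, List.not_mem_nil, or_false] at ha
    obtain ⟨x, hx, rfl | rfl⟩ := ha <;> simp [alwR, Nat.ne_of_lt hx]
  · simp [alwR]

/-- The one-level sum of the reduced search over the children, as a range sum. [cite: MadrasSlade1993, Definition 1.2.4] -/
theorem foldr_lts_alwR (g : ℕ × Bool → ℕ) (m : ℕ) :
    (lts alwR m).foldr (fun a acc => acc + g a) 0 = (∑ i ∈ Finset.range m, (g (i, true) + g (i, false))) + g (m, true) := by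
  rw [foldr_add_eq_sum, lts_alwR_eq, List.map_append, List.sum_append, sum_map_letters]
  simp

/-- A dead node has value `0`. [cite: MadrasSlade1993, Definition 1.2.4] -/
theorem fastV_of_not_alive (B : ℕ) {t : Tri} (h : alive t = false) (j k mask : ℕ) (vs : List ℕ) (m : ℕ) :
    fastV B j t k mask vs m = 0 := by
  cases j <;> simp [fastV, h]

/-- `nxt m (i, b) = m` for an old axis `i < m`. [cite: MadrasSlade1993, Definition 1.2.4] -/
theorem nxt_of_lt {m i : ℕ} (h : i < m) (b : Bool) : nxt m (i, b) = m := by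
  unfold nxt; exact max_eq_left (by simpa using h)

/-- `nxt m (m, b) = m + 1` for the new axis. [cite: MadrasSlade1993, Definition 1.2.4] -/
theorem nxt_self (m : ℕ) (b : Bool) : nxt m (m, b) = m + 1 := by
  unfold nxt; exact max_eq_right (Nat.le_succ m)

/-- ★ THE EVALUATOR IS THE CENSUS: `fastS B j s m = dfsV alwR updF okF clsF 1 N B j s m` (one class; the stride `N` is immaterial).
[cite: MadrasSlade1993, Definition 1.2.4] -/
theorem fastS_eq_dfsV (B N : ℕ) : ∀ (j : ℕ) (s : FS) (m : ℕ), fastS B j s m = dfsV alwR updF okF clsF 1 N B j s m := by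
  intro j
  induction j with
  | zero =>
    intro s m
    simp only [fastS, fastV, dfsV, leafV, okF, List.range_succ, List.range_zero, List.nil_append, List.foldr_cons,
      List.foldr_nil, clsF, if_true, Nat.mul_zero, Nat.zero_add]
    cases (alive s.node && !memM s.key s.mask s.vis) <;> simp
  | succ j ih =>
    intro s m
    have hok : (alive s.node && !memM s.key s.mask s.vis) = okF s := rfl
    rw [dfsV]
    by_cases h : okF s = true
    · rw [if_pos h, foldr_lts_alwR]
      simp only [← ih]
      rw [fastS, fastV, hok, h, cond_true]
      -- the children, by shape
      have hU : fastS B j (updF s (0, true)) (nxt m (0, true)) =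
          fastV B j (desc s.node 0) (s.key + 1) (Nat.lor s.mask (slot s.key)) (s.key :: s.vis) (nxt m (0, true)) := by
        simp [fastS, updF, vlet, newKey]
      have hD : fastS B j (updF s (0, false)) (nxt m (0, false)) =
          fastV B j (desc s.node 1) (s.key - 1) (Nat.lor s.mask (slot s.key)) (s.key :: s.vis) (nxt m (0, false)) := by
        simp [fastS, updF, vlet, newKey]
      have hT : ∀ i (b : Bool), fastS B j (updF s (i + 1, b)) (nxt m (i + 1, b)) =
          fastV B j (desc s.node 2) (bif b then s.key + 32 ^ (i + 1) else s.key - 32 ^ (i + 1)) (Nat.lor s.mask (slot s.key))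
            (s.key :: s.vis) (nxt m (i + 1, b)) := by
        intro i b; cases b <;> simp [fastS, updF, vlet, newKey]
      rcases Nat.eq_zero_or_pos m with rfl | hm
      · -- root level: the only letter is `(0, true)`
        rw [nxt_self, Nat.zero_add] at hU
        simp only [Finset.range_zero, Finset.sum_empty, zero_add, Nat.beq, cond_true, pow_zero, nxt_self]
        exact hU.symm
      · obtain ⟨m', rfl⟩ : ∃ m', m = m' + 1 := ⟨m - 1, by omega⟩
        have hb : Nat.beq (m' + 1) 0 = false := rfl
        simp only [hb, cond_false, Nat.add_sub_cancel]
        rw [Finset.sum_range_succ', hU, hD, nxt_of_lt hm, nxt_of_lt hm]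
        have hnew : fastS B j (updF s (m' + 1, true)) (nxt (m' + 1) (m' + 1, true)) =
            fastV B j (desc s.node 2) (s.key + 32 ^ (m' + 1)) (Nat.lor s.mask (slot s.key)) (s.key :: s.vis) (m' + 1 + 1) := by
          rw [hT, nxt_self]; rfl
        rw [hnew]
        have hsum : ∑ i ∈ Finset.range m', (fastS B j (updF s (i + 1, true)) (nxt (m' + 1) (i + 1, true)) +
              fastS B j (updF s (i + 1, false)) (nxt (m' + 1) (i + 1, false))) =
            (bif alive (desc s.node 2) then
              sumTo (fun i => fastV B j (desc s.node 2) (s.key + 32 ^ (i + 1)) (Nat.lor s.mask (slot s.key)) (s.key :: s.vis) (m' + 1) +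
                fastV B j (desc s.node 2) (s.key - 32 ^ (i + 1)) (Nat.lor s.mask (slot s.key)) (s.key :: s.vis) (m' + 1)) m'
            else 0) := by
          cases ha : alive (desc s.node 2)
          · simp only [cond_false]
            refine Finset.sum_eq_zero fun i hi => ?_
            rw [hT, hT]; simp [fastV_of_not_alive B ha]
          · simp only [cond_true, sumTo_eq_sum]
            refine Finset.sum_congr rfl fun i hi => ?_
            have hi' : i + 1 < m' + 1 := by simpa using Finset.mem_range.1 hi
            rw [hT, hT, nxt_of_lt hi', nxt_of_lt hi']; rfl
        rw [hsum]; ring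
    · have h' : okF s = false := by simpa using h
      rw [if_neg h, fastS, fastV, hok, h', cond_false]

end evaluator

/-! ### §3 Semantics: along a canonical word the lean state is the trie node of the vertical pattern, the key of the endpoint and the
keys of the earlier points — so its pruning test IS the two-level test `okT` of `…ZdBridgeSearch` -/

section semantics

/-- The trie descended along a whole pattern. [cite: MadrasSlade1993, Definition 1.2.4] -/
def tdesc : Tri → List ℕ → Tri
  | t, [] => t
  | t, x :: p => tdesc (desc t x) p

/-- Descending along `p ++ [x]`. [cite: MadrasSlade1993, Definition 1.2.4] -/
theorem tdesc_append_singleton (t : Tri) (p : List ℕ) (x : ℕ) : tdesc t (p ++ [x]) = desc (tdesc t p) x := by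
  induction p generalizing t with
  | nil => rfl
  | cons y p ih => exact ih _

/-- ★ The descended node is alive iff the pattern passes the trie. [cite: MadrasSlade1993, Definition 1.2.4] -/
theorem alive_tdesc : ∀ (p : List ℕ) (t : Tri), alive (tdesc t p) = inTrie t p := by
  intro p
  induction p with
  | nil => intro t; cases t <;> rfl
  | cons x p ih =>
    intro t
    cases t with
    | no => simp only [tdesc, desc, ih, inTrie]
    | yes => simp only [tdesc, desc, ih, inTrie]
    | br u d t => simp only [tdesc, desc, inTrie, ih]

/-- The vertical pattern of a state with one more letter in front. [cite: MadrasSlade1993, Definition 1.2.4] -/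
theorem vpatF_cons (f a : ℕ × Bool) (s : List (ℕ × Bool)) : vpatF f (a :: s) = vpatF f s ++ [vlet f a] := by
  simp [vpatF]

/-- Digit `a` of the key of a site over `L` axes: `16 +` its coordinate `a + 1` (coordinate `0` is unused). [cite: MadrasSlade1993, Definition 1.2.4] -/
def dg (L : ℕ) (v : Site (L + 1)) (a : ℕ) : ℕ := if h : a < L then (16 + v ⟨a + 1, by omega⟩).toNat else 0

/-- ★ The key of a site: base-`32` digits `16 + coordinate`. [cite: MadrasSlade1993, Definition 1.2.4] -/
def encS (L : ℕ) (v : Site (L + 1)) : ℕ := ∑ a ∈ Finset.range L, dg L v a * 32 ^ a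

/-- The origin's key is `key0`. [cite: MadrasSlade1993, Definition 1.2.4] -/
theorem sum_sixteen_mul_pow (L : ℕ) : ∑ a ∈ Finset.range L, 16 * 32 ^ a = key0 L := by
  induction L with
  | zero => rfl
  | succ L ih =>
    rw [key0, ← ih, Finset.sum_range_succ', Finset.mul_sum]
    simp only [pow_succ, pow_zero, mul_one]
    rw [add_comm]
    congr 1
    exact Finset.sum_congr rfl fun a _ => by ring

/-- `encS L 0 = key0 L`. [cite: MadrasSlade1993, Definition 1.2.4] -/
theorem encS_zero (L : ℕ) : encS L 0 = key0 L := by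
  rw [encS, ← sum_sixteen_mul_pow]
  refine Finset.sum_congr rfl fun a ha => ?_
  rw [dg, dif_pos (Finset.mem_range.1 ha)]
  simp

/-- ★ ONE STEP: the key of `v + e` (`e` the step of the raw letter `(a, b)`) is `newKey (encS v) (a, b)`, provided the digit moved is positive.
[cite: MadrasSlade1993, Definition 1.2.4] -/
theorem encS_add_twoStepV (L : ℕ) (v : Site (L + 1)) (x : Idx L) (hv : -15 ≤ v x.1.succ) :
    encS L (v + twoStepV L x) = newKey (encS L v) (raw x) := by
  have hx : x.1.val ∈ Finset.range L := Finset.mem_range.2 x.1.isLt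
  -- digits off the moved axis are unchanged
  have hoff : ∀ a ∈ (Finset.range L).erase x.1.val, dg L (v + twoStepV L x) a * 32 ^ a = dg L v a * 32 ^ a := by
    intro a ha
    obtain ⟨hne, haL⟩ := Finset.mem_erase.1 ha
    have haL' := Finset.mem_range.1 haL
    have hne' : (⟨a + 1, by omega⟩ : Fin (L + 1)) ≠ x.1.succ := by
      intro h; apply hne; have := congrArg Fin.val h; simp at this; omega
    simp only [dg, dif_pos haL', Pi.add_apply, twoStepV, Pi.single_apply, if_neg hne', add_zero]
  -- the moved digit
  have hsucc : (⟨x.1.val + 1, by omega⟩ : Fin (L + 1)) = x.1.succ := by ext; simp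
  have hon : dg L (v + twoStepV L x) x.1.val = if x.2 then dg L v x.1.val + 1 else dg L v x.1.val - 1 := by
    simp only [dg, dif_pos x.1.isLt, Pi.add_apply, hsucc, twoStepV, Pi.single_eq_same]
    cases x.2
    · simp only [Bool.false_eq_true, ↓reduceIte]; omega
    · simp only [↓reduceIte]; omega
  have hpos : 1 ≤ dg L v x.1.val := by
    simp only [dg, dif_pos x.1.isLt, hsucc]; omega
  rw [encS, encS, ← Finset.add_sum_erase _ _ hx, ← Finset.add_sum_erase _ (fun a => dg L v a * 32 ^ a) hx,
    Finset.sum_congr rfl hoff, hon]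
  obtain ⟨⟨a, ha⟩, b⟩ := x
  cases b
  · simp only [Bool.false_eq_true, ↓reduceIte, newKey, raw, cond_false]
    rw [Nat.sub_one_mul]
    have : 32 ^ a ≤ dg L v a * 32 ^ a := Nat.le_mul_of_pos_left _ hpos
    omega
  · simp only [↓reduceIte, newKey, raw, cond_true]
    ring

/-- The key as `Nat.ofDigits`. [cite: MadrasSlade1993, Definition 1.2.4] -/
theorem encS_eq_ofDigits (L : ℕ) (v : Site (L + 1)) : encS L v = Nat.ofDigits 32 ((List.range L).map (dg L v)) := by
  rw [encS, sum_mul_pow_eq_ofDigits]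

/-- ★ INJECTIVITY on the box: sites with zero height coordinate and all coordinates in `[-15, 15]` have distinct keys. [cite: MadrasSlade1993, Definition 1.2.4] -/
theorem encS_injective_of_bounds (L : ℕ) {v w : Site (L + 1)} (hv0 : v 0 = 0) (hw0 : w 0 = 0)
    (hv : ∀ b, -15 ≤ v b ∧ v b ≤ 15) (hw : ∀ b, -15 ≤ w b ∧ w b ≤ 15) (h : encS L v = encS L w) : v = w := by
  rw [encS_eq_ofDigits, encS_eq_ofDigits] at h
  have hdig : ∀ (u : Site (L + 1)), (∀ b, -15 ≤ u b ∧ u b ≤ 15) → ∀ y ∈ (List.range L).map (dg L u), y < 32 := by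
    intro u hu y hy
    obtain ⟨a, -, rfl⟩ := List.mem_map.1 hy
    unfold dg
    split_ifs with ha
    · have := hu ⟨a + 1, by omega⟩; omega
    · norm_num
  have hl := ofDigits_inj_of_length_eq _ _ (by simp) (hdig v hv) (hdig w hw) h
  rw [List.map_eq_map_iff] at hl
  funext b
  refine Fin.cases ?_ (fun a => ?_) b
  · rw [hv0, hw0]
  · have ha := hl a.val (List.mem_range.2 a.isLt)
    simp only [dg, dif_pos a.isLt] at ha
    have h1 := hv a.succ
    have h2 := hw a.succ
    have e : (⟨a.val + 1, by omega⟩ : Fin (L + 1)) = a.succ := by ext; simp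
    rw [e] at ha
    have := congrArg (fun n : ℕ => (n : ℤ)) ha
    simp only [Int.toNat_of_nonneg (by omega : (0:ℤ) ≤ 16 + v a.succ), Int.toNat_of_nonneg (by omega : (0:ℤ) ≤ 16 + w a.succ)] at this
    omega

/-- A step changes one coordinate by one. [cite: MadrasSlade1993, Definition 1.2.4] -/
theorem twoStepV_apply_bounds (n : ℕ) (x : Idx n) (b : Fin (n + 1)) : -1 ≤ twoStepV n x b ∧ twoStepV n x b ≤ 1 := by
  unfold twoStepV
  by_cases hb : b = x.1.succ
  · subst hb; rw [Pi.single_eq_same]; split_ifs <;> simp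
  · rw [Pi.single_eq_of_ne hb]; simp

/-- Block sums split at an intermediate time. [cite: MadrasSlade1993, Definition 1.2.4] -/
theorem bsumW_add {L n : ℕ} (w : Word L n) {i j k : ℕ} (hij : i ≤ j) (hjk : j ≤ k) (hk : k ≤ L) :
    bsumW w i k = bsumW w i j + bsumW w j k := by
  induction k, hjk using Nat.le_induction with
  | base => rw [bsumW_self, add_zero]
  | succ k hk' ih =>
    rw [bsumW_succ w (le_trans hij hk') (by omega), bsumW_succ w hk' (by omega), ih (by omega), add_assoc]

/-- The position after `i ≤ L` letters has all coordinates in `[-i, i]`. [cite: MadrasSlade1993, Definition 1.2.4] -/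
theorem bsumW_zero_bounds {L n : ℕ} (w : Word L n) : ∀ i, i ≤ L → ∀ b, -(i : ℤ) ≤ bsumW w 0 i b ∧ bsumW w 0 i b ≤ i := by
  intro i
  induction i with
  | zero => intro _ b; simp [bsumW_self]
  | succ i ih =>
    intro hi b
    rw [bsumW_succ w (Nat.zero_le i) (by omega), Pi.add_apply]
    have h1 := ih (by omega) b
    have h2 := twoStepV_apply_bounds n (w ⟨i, by omega⟩) b
    push_cast
    omega

/-- The key of the position after `i` letters of a word over `L` axes. [cite: MadrasSlade1993, Definition 1.2.4] -/
def keyW {L : ℕ} (τ : Word L L) (i : ℕ) : ℕ := encS L (bsumW τ 0 i)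

/-- The keys of the earlier positions, most recent first. [cite: MadrasSlade1993, Definition 1.2.4] -/
def visW {L : ℕ} (τ : Word L L) (i : ℕ) : List ℕ := ((List.range i).map (keyW τ)).reverse

/-- The bitmask of a key list. [cite: MadrasSlade1993, Definition 1.2.4] -/
def maskOf : List ℕ → ℕ
  | [] => 0
  | v :: vs => Nat.lor (maskOf vs) (slot v)

/-- `visW` grows by the previous endpoint's key. [cite: MadrasSlade1993, Definition 1.2.4] -/
theorem visW_succ {L : ℕ} (τ : Word L L) (i : ℕ) : visW τ (i + 1) = keyW τ i :: visW τ i := by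
  simp [visW, List.range_succ]

/-- `memN` is list membership. [cite: MadrasSlade1993, Definition 1.2.4] -/
theorem memN_iff (k : ℕ) : ∀ l : List ℕ, memN k l = true ↔ k ∈ l := by
  intro l
  induction l with
  | nil => simp [memN]
  | cons x xs ih =>
    rw [memN, Bool.or_eq_true, ih, List.mem_cons]
    constructor
    · rintro (h | h)
      · exact Or.inl (Nat.eq_of_beq_eq_true h)
      · exact Or.inr h
    · rintro (rfl | h)
      · exact Or.inl (Nat.beq_refl k)
      · exact Or.inr h

/-- A listed key has its slot set in the mask. [cite: MadrasSlade1993, Definition 1.2.4] -/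
theorem land_maskOf_slot_ne_zero {k : ℕ} : ∀ {vs : List ℕ}, k ∈ vs → Nat.land (maskOf vs) (slot k) ≠ 0 := by
  intro vs
  induction vs with
  | nil => intro h; simp at h
  | cons v vs ih =>
    intro h
    rw [maskOf]
    change (maskOf vs ||| slot v) &&& slot k ≠ 0
    rw [Nat.and_or_distrib_right]
    intro h0
    rcases List.mem_cons.1 h with rfl | h
    · have h1 : Nat.testBit (maskOf vs &&& slot k ||| slot k &&& slot k) (k % 4093) = true := by
        rw [Nat.and_self, Nat.testBit_lor, slot, Nat.testBit_two_pow_self, Bool.or_true]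
      rw [h0, Nat.zero_testBit] at h1
      exact Bool.false_ne_true h1
    · have ih' : maskOf vs &&& slot k ≠ 0 := ih h
      obtain ⟨i, hi⟩ := Nat.exists_testBit_of_ne_zero ih'
      have h1 : Nat.testBit (maskOf vs &&& slot k ||| slot v &&& slot k) i = true := by
        rw [Nat.testBit_lor, hi, Bool.true_or]
      rw [h0, Nat.zero_testBit] at h1
      exact Bool.false_ne_true h1

/-- ★ With the mask of the listed keys, the two-level membership test is plain membership. [cite: MadrasSlade1993, Definition 1.2.4] -/
theorem memM_maskOf (k : ℕ) (vs : List ℕ) : memM k (maskOf vs) vs = memN k vs := by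
  unfold memM
  cases h : memN k vs
  · rw [Bool.and_false]
  · rw [Bool.and_true]
    have hne := land_maskOf_slot_ne_zero ((memN_iff k vs).1 h)
    cases hb : Nat.beq (Nat.land (maskOf vs) (slot k)) 0
    · rfl
    · exact absurd (Nat.eq_of_beq_eq_true hb) hne

/-- ★★ THE LEAN STATE ALONG A WORD: after `i ≤ L` letters of a word `τ` over `L ≤ 15` axes the lean state is (trie node of the vertical
pattern relative to `(0, true)`, key of the endpoint, bitmask and list of the earlier keys). [cite: MadrasSlade1993, Definition 1.2.4] -/
theorem st_updF_take (tr : Tri) {L : ℕ} (hL : L ≤ 15) (τ : Word L L) : ∀ i, i ≤ L →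
    st updF (s0F tr L) ((rawW τ).take i) =
      ⟨tdesc tr (vpatF (0, true) (st updR [] ((rawW τ).take i))), keyW τ i, maskOf (visW τ i), visW τ i⟩ := by
  intro i
  induction i with
  | zero =>
    intro _
    simp only [List.take_zero, st, List.foldl_nil, s0F, vpatF, List.map_nil, List.reverse_nil, tdesc, keyW, bsumW_self, encS_zero,
      visW, List.range_zero, maskOf]
  | succ i ih =>
    intro hi
    have hi' : i < L := hi
    rw [rawW_take_succ τ i hi', st_append_singleton, st_append_singleton, ih hi'.le, updF, updR, vpatF_cons, tdesc_append_singleton,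
      visW_succ, maskOf, keyW, keyW, bsumW_succ τ (Nat.zero_le i) hi', encS_add_twoStepV]
    have hb := (bsumW_zero_bounds τ i hi'.le (τ ⟨i, hi'⟩).1.succ).1
    omega

/-- The first letter of a reduced canonical word is `(0, true)`. [cite: MadrasSlade1993, Definition 1.2.4] -/
theorem raw_zero_of_rgA_alwR {n : ℕ} (τ : Word (n + 1) (n + 1)) (h : rgA alwR 0 (rawW τ) = true) : raw (τ 0) = (0, true) := by
  unfold rawW at h
  rw [List.ofFn_succ, rgA] at h
  simp only [Bool.and_eq_true] at h
  obtain ⟨⟨h1, h2⟩, -⟩ := h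
  have ha : (raw (τ 0)).1 = 0 := Nat.le_zero.1 (Nat.le_of_ble_eq_true h1)
  unfold alwR at h2
  rw [ha] at h2
  have hb : (raw (τ 0)).2 = true := by simpa using h2
  exact Prod.ext ha hb

/-- ★★★ ON A CANONICAL WORD THE LEAN TEST IS THE TWO-LEVEL TEST: for a word over `n + 1 ≤ 15` axes starting with `(0, true)`, at every prefix
the lean state's pruning test `okF` equals `okT tr (n+1)` of `…ZdBridgeSearch` on the reversed-prefix state. [cite: MadrasSlade1993, Definition 1.2.4] -/
theorem okF_st_eq_okT (tr : Tri) {n : ℕ} (hn : n + 1 ≤ 15) (τ : Word (n + 1) (n + 1)) (h0 : raw (τ 0) = (0, true)) (i : ℕ)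
    (hi : i ≤ n + 1) :
    okF (st updF (s0F tr (n + 1)) ((rawW τ).take i)) = okT tr (n + 1) (st updR [] ((rawW τ).take i)) := by
  rw [st_updF_take tr hn τ i hi, okF, okT_eq, alive_tdesc, memM_maskOf]
  -- the trie conjunct: the pattern relative to the first letter
  have htrie : inTrie tr (vpatF (0, true) (st updR [] ((rawW τ).take i))) = inTrie tr (vpatF (fL (st updR [] ((rawW τ).take i))) (st updR [] ((rawW τ).take i))) := by
    rcases Nat.eq_zero_or_pos i with rfl | hpos
    · simp [st, vpatF]
    · obtain ⟨j, rfl⟩ : ∃ j, i = j + 1 := ⟨i - 1, by omega⟩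
      rw [fL_st τ j, h0]
  rw [htrie]
  congr 1
  -- the self-avoidance conjunct
  rw [Bool.eq_iff_iff, Bool.not_eq_true', okR_st_iff τ hi, ← Bool.not_eq_true, memN_iff]
  simp only [visW, List.mem_reverse, List.mem_map, List.mem_range, not_exists, not_and]
  constructor
  · intro h j hj0 hji hz
    refine h (i - j) (by omega) ?_
    rw [keyW, keyW, bsumW_add τ (Nat.zero_le _) (Nat.sub_le i j) hi, hz, add_zero]
  · intro h j hji hk
    have hinj := encS_injective_of_bounds (n + 1) (bsumW_apply_zero τ 0 j) (bsumW_apply_zero τ 0 i)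
      (fun b => by have := bsumW_zero_bounds τ j (by omega) b; omega)
      (fun b => by have := bsumW_zero_bounds τ i hi b; omega) hk
    refine h (i - j) (by omega) (by omega) ?_
    have hs := bsumW_add τ (Nat.zero_le _) hji.le hi
    rw [show i - (i - j) = j by omega]
    rw [hinj] at hs
    exact left_eq_add.1 hs

/-- ★★★ THE LEAN SEARCH COUNTS = THE TWO-LEVEL SEARCH COUNTS (every class index, every axis count). [cite: MadrasSlade1993, Definition 1.2.4] -/
theorem dfsN_fast_eq (tr : Tri) {n : ℕ} (hn : n + 1 ≤ 15) (k : ℕ) :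
    dfsN alwR updF okF clsF 0 k (n + 1) (s0F tr (n + 1)) 0 = dfsN alwR updR (okT tr (n + 1)) clsT 0 k (n + 1) ([] : List (ℕ × Bool)) 0 := by
  rw [← card_TL_class alwR updF okF clsF (s0F tr (n + 1)) 0 k, ← card_TL_class alwR updR (okT tr (n + 1)) clsT ([] : List (ℕ × Bool)) 0 k]
  congr 1
  refine congrArg (Finset.filter _) (Finset.filter_congr fun τ _ => ?_)
  have hF : clsF 0 (st updF (s0F tr (n + 1)) (rawW τ)) = true := rfl
  have hT : clsT 0 (st updR [] (rawW τ)) = true := rfl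
  simp only [hF, hT, and_true]
  refine and_congr_right fun hc => ?_
  have h0 := raw_zero_of_rgA_alwR τ hc
  unfold PrefixOK
  exact forall_congr' fun i => by rw [okF_st_eq_okT tr hn τ h0 i.val (Nat.le_of_lt_succ i.isLt)]

/-- ★★★ **THE COST CENSUS BY THE LEAN SEARCH**: for a trie certified by `patOK tr c n [0]`, `N_{c,n+1}(ℤ^{d+1}) = Σ_{k<n+1} 2^k m_{k+1} d^{(k)}` in every
dimension `d`, with `m_k` the lean machine's reduced counts `dfsN alwR updF okF clsF 0 k (n+1) (s0F tr (n+1)) 0` (`n + 1 ≤ 15`).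
[cite: MadrasSlade1993, §4.2, eq. (4.2.20)–(4.2.22) (p. 94, 2013 reprint)] -/
theorem costCoeffZd_eq_sum_fast (d c n : ℕ) (tr : Tri) (htr : patOK tr c n [0] = true) (h0 : inTrie tr [] = true) (hn : n + 1 ≤ 15)
    (m : ℕ → ℕ) (hm : ∀ k, k ≤ n + 1 → dfsN alwR updF okF clsF 0 k (n + 1) (s0F tr (n + 1)) 0 = m k) (hm0 : m 0 = 0) :
    costCoeffZd d c (n + 1) = ∑ k ∈ Finset.range (n + 1), 2 ^ k * m (k + 1) * d.descFactorial k :=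
  costCoeffZd_eq_sum_trie d c n tr htr h0 m (fun k hk => by rw [← dfsN_fast_eq tr hn k]; exact hm k hk) hm0

/-- ★ THE DIGITS OF THE LEAN CENSUS VALUE: if `fastS B L (s0F tr L) 0 = Nat.ofDigits B tab` for a table of `L + 1` entries `< B` with
`(2L)^L < B`, the reduced counts are the table entries. [cite: MadrasSlade1993, Definition 1.2.4] -/
theorem dfsN_fast_of_table (tr : Tri) (L B : ℕ) (hB : (2 * L) ^ L < B) (tab : List ℕ) (hlen : tab.length = L + 1)
    (hlt : ∀ x ∈ tab, x < B) (hV : fastS B L (s0F tr L) 0 = Nat.ofDigits B tab) (k : ℕ) (hk : k ≤ L) :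
    dfsN alwR updF okF clsF 0 k L (s0F tr L) 0 = tab.getD k 0 := by
  have hV' : dfsV alwR updF okF clsF 1 (L + 1) B L (s0F tr L) 0 = Nat.ofDigits (B ^ (L + 1)) ([tab].map (Nat.ofDigits B)) := by
    rw [← fastS_eq_dfsV, hV]; simp
  have h := dfsN_eq_of_table alwR updF okF clsF (s0F tr L) hB [tab] rfl (fun r hr => by simp only [List.mem_singleton] at hr; rw [hr, hlen])
    (fun r hr x hx => by simp only [List.mem_singleton] at hr; rw [hr] at hx; exact hlt x hx) hV' (c := 0) (k := k) Nat.one_pos hk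
  simpa using h

/-- ★★★ **A COST CELL FROM ONE LEAN CENSUS VALUE**: for a certified trie and `fastS B (n+1) (s0F tr (n+1)) 0 = Nat.ofDigits B tab` (table by
total number of axes, `n + 2` entries `< B`, first entry `0`, `(2(n+1))^{n+1} < B`, `n + 1 ≤ 15`):
`N_{c,n+1}(ℤ^{d+1}) = Σ_{k<n+1} 2^k · tab[k+1] · d^{(k)}` in every dimension `d`. [cite: MadrasSlade1993, §4.2, eq. (4.2.20)–(4.2.22) (p. 94, 2013 reprint)] -/
theorem costCoeffZd_eq_sum_of_fastS (d c n : ℕ) (tr : Tri) (htr : patOK tr c n [0] = true) (h0 : inTrie tr [] = true) (hn : n + 1 ≤ 15)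
    (B : ℕ) (hB : (2 * (n + 1)) ^ (n + 1) < B) (tab : List ℕ) (hlen : tab.length = n + 2) (hlt : ∀ x ∈ tab, x < B)
    (htab0 : tab.getD 0 0 = 0) (hV : fastS B (n + 1) (s0F tr (n + 1)) 0 = Nat.ofDigits B tab) :
    costCoeffZd d c (n + 1) = ∑ k ∈ Finset.range (n + 1), 2 ^ k * tab.getD (k + 1) 0 * d.descFactorial k :=
  costCoeffZd_eq_sum_fast d c n tr htr h0 hn (fun k => tab.getD k 0)
    (fun k hk => dfsN_fast_of_table tr (n + 1) B hB tab hlen hlt hV k hk) htab0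

end semantics

/-! ### §4 Assembly by table: a census value evaluated in pieces

The kernel's memory budget caps one evaluation; a large cell is evaluated as many sub-cells (sub-searches below short raw prefixes, each
its own theorem `fastS B j (st updF s₀ w) m = Nat.ofDigits B digits`).  `fastVT` re-runs the TOP of the search reading those values
from a table `T` of entries `(w, j, m, digits)` instead of descending; ★★ `fastVT_eq`: if every entry of the table is a true statement
about `fastS`, the table-driven value IS `fastS` — so the root value is one more (small) kernel evaluation. -/

section assembly

/-- Look a raw prefix up in a cell table: its digit list, if present. [cite: MadrasSlade1993, Definition 1.2.4] -/
def lookupT : List (List (ℕ × Bool) × ℕ × ℕ × List ℕ) → List (ℕ × Bool) → Option (List ℕ)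
  | [], _ => none
  | e :: T, w => if e.1 = w then some e.2.2.2 else lookupT T w

/-- A successful lookup is an entry of the table. [cite: MadrasSlade1993, Definition 1.2.4] -/
theorem exists_mem_of_lookupT : ∀ (T : List (List (ℕ × Bool) × ℕ × ℕ × List ℕ)) (w : List (ℕ × Bool)) (ds : List ℕ),
    lookupT T w = some ds → ∃ j m, (w, j, m, ds) ∈ T := by
  intro T
  induction T with
  | nil => intro w ds h; simp [lookupT] at h
  | cons e T ih =>
    intro w ds h
    rw [lookupT] at h
    split_ifs at h with he
    · refine ⟨e.2.1, e.2.2.1, ?_⟩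
      rw [← he, ← Option.some.inj h]
      exact List.mem_cons_self
    · obtain ⟨j, m, hm⟩ := ih w ds h
      exact ⟨j, m, List.mem_cons_of_mem _ hm⟩

/-- ★ THE TABLE-DRIVEN EVALUATOR: the reduced search from the root by raw prefixes, reading the value of any prefix found in the table `T`
(as `Nat.ofDigits B digits`) instead of searching below it. [cite: MadrasSlade1993, Definition 1.2.4] -/
def fastVT (T : List (List (ℕ × Bool) × ℕ × ℕ × List ℕ)) (B : ℕ) (s₀ : FS) : ℕ → List (ℕ × Bool) → ℕ → ℕ
  | 0, w, m => fastS B 0 (st updF s₀ w) m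
  | j + 1, w, m =>
    match lookupT T w with
    | some ds => Nat.ofDigits B ds
    | none =>
      bif okF (st updF s₀ w) then
        (bif Nat.beq m 0 then 0 else
          (fastVT T B s₀ j (w ++ [(0, true)]) m + fastVT T B s₀ j (w ++ [(0, false)]) m +
            sumTo (fun i => fastVT T B s₀ j (w ++ [(i + 1, true)]) m + fastVT T B s₀ j (w ++ [(i + 1, false)]) m) (m - 1))) +
          fastVT T B s₀ j (w ++ [(m, true)]) (m + 1)
      else 0

/-- One level of `fastS` below a live state, child by child (the transverse group without its guard). [cite: MadrasSlade1993, Definition 1.2.4] -/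
theorem fastS_succ (B j : ℕ) (s : FS) (m : ℕ) (h : okF s = true) :
    fastS B (j + 1) s m =
      (bif Nat.beq m 0 then 0 else
        (fastS B j (updF s (0, true)) m + fastS B j (updF s (0, false)) m +
          sumTo (fun i => fastS B j (updF s (i + 1, true)) m + fastS B j (updF s (i + 1, false)) m) (m - 1))) +
        fastS B j (updF s (m, true)) (m + 1) := by
  have hok : (alive s.node && !memM s.key s.mask s.vis) = okF s := rfl
  rw [fastS, fastV, hok, h, cond_true]
  have hU : fastS B j (updF s (0, true)) m = fastV B j (desc s.node 0) (s.key + 1) (Nat.lor s.mask (slot s.key)) (s.key :: s.vis) m := by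
    simp [fastS, updF, vlet, newKey]
  have hD : fastS B j (updF s (0, false)) m = fastV B j (desc s.node 1) (s.key - 1) (Nat.lor s.mask (slot s.key)) (s.key :: s.vis) m := by
    simp [fastS, updF, vlet, newKey]
  have hT : ∀ i (b : Bool) m', fastS B j (updF s (i + 1, b)) m' =
      fastV B j (desc s.node 2) (bif b then s.key + 32 ^ (i + 1) else s.key - 32 ^ (i + 1)) (Nat.lor s.mask (slot s.key)) (s.key :: s.vis) m' := by
    intro i b m'; cases b <;> simp [fastS, updF, vlet, newKey]
  rcases Nat.eq_zero_or_pos m with rfl | hm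
  · simp only [Nat.beq, cond_true, zero_add, pow_zero]
    simp [fastS, updF, vlet, newKey]
  · obtain ⟨m', rfl⟩ : ∃ m', m = m' + 1 := ⟨m - 1, by omega⟩
    have hb : Nat.beq (m' + 1) 0 = false := rfl
    simp only [hb, cond_false, Nat.add_sub_cancel, hU, hD]
    rw [hT m' true]
    simp only [cond_true]
    congr 2
    cases ha : alive (desc s.node 2)
    · simp only [cond_false, sumTo_eq_sum]
      symm
      refine Finset.sum_eq_zero fun i _ => ?_
      rw [hT, hT]; simp [fastV_of_not_alive B ha]
    · simp only [cond_true, sumTo_eq_sum]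
      refine Finset.sum_congr rfl fun i _ => ?_
      rw [hT, hT]; rfl

/-- Zero letters to go: `fastS` does not see the table. [cite: MadrasSlade1993, Definition 1.2.4] -/
theorem fastVT_zero (T : List (List (ℕ × Bool) × ℕ × ℕ × List ℕ)) (B : ℕ) (s₀ : FS) (w : List (ℕ × Bool)) (m : ℕ) :
    fastVT T B s₀ 0 w m = fastS B 0 (st updF s₀ w) m := rfl

/-- `sumTo` depends only on the values below the bound. [cite: MadrasSlade1993, Definition 1.2.4] -/
theorem sumTo_congr {f g : ℕ → ℕ} {m : ℕ} (h : ∀ i, i < m → f i = g i) : sumTo f m = sumTo g m := by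
  rw [sumTo_eq_sum, sumTo_eq_sum]
  exact Finset.sum_congr rfl fun i hi => h i (Finset.mem_range.1 hi)

/-- ★★ SOUNDNESS OF THE TABLE: if every entry `(w, j, m, digits)` of `T` is TRUE — `fastS B j (st updF s₀ w) m = Nat.ofDigits B digits` with
`|w| + j = L` and `m` the axis count of `w` — then the table-driven value from any prefix is the true value:
`fastVT T B s₀ j w (naxL 0 w) = fastS B j (st updF s₀ w) (naxL 0 w)` whenever `|w| + j = L`. [cite: MadrasSlade1993, Definition 1.2.4] -/
theorem fastVT_eq (T : List (List (ℕ × Bool) × ℕ × ℕ × List ℕ)) (B : ℕ) (s₀ : FS) (L : ℕ)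
    (hT : ∀ e ∈ T, e.1.length + e.2.1 = L ∧ naxL 0 e.1 = e.2.2.1 ∧ fastS B e.2.1 (st updF s₀ e.1) e.2.2.1 = Nat.ofDigits B e.2.2.2) :
    ∀ (j : ℕ) (w : List (ℕ × Bool)), w.length + j = L → fastVT T B s₀ j w (naxL 0 w) = fastS B j (st updF s₀ w) (naxL 0 w) := by
  intro j
  induction j with
  | zero => intro w _; rfl
  | succ j ih =>
    intro w hw
    rw [fastVT]
    cases hl : lookupT T w with
    | some ds =>
      simp only
      obtain ⟨j', m', hmem⟩ := exists_mem_of_lookupT T w ds hl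
      obtain ⟨h1, h2, h3⟩ := hT _ hmem
      simp only at h1 h2 h3
      obtain rfl : j' = j + 1 := by omega
      rw [← h2] at h3
      exact h3.symm
    | none =>
      simp only
      cases hok : okF (st updF s₀ w)
      · -- a dead prefix: `fastS` is `0` as well
        have : fastS B (j + 1) (st updF s₀ w) (naxL 0 w) = 0 := by
          have hok' : (alive (st updF s₀ w).node && !memM (st updF s₀ w).key (st updF s₀ w).mask (st updF s₀ w).vis) = false := hok
          rw [fastS, fastV, hok', cond_false]
        rw [this]; rfl
      · rw [cond_true, fastS_succ B j _ _ hok]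
        have hch : ∀ a : ℕ × Bool, fastVT T B s₀ j (w ++ [a]) (naxL 0 (w ++ [a])) = fastS B j (updF (st updF s₀ w) a) (naxL 0 (w ++ [a])) := by
          intro a
          rw [ih (w ++ [a]) (by simp; omega), st_append_singleton]
        have hn : ∀ a : ℕ × Bool, naxL 0 (w ++ [a]) = nxt (naxL 0 w) a := fun a => naxL_append_singleton 0 w a
        set m := naxL 0 w with hm
        have hnew := hch (m, true)
        rw [hn, nxt_self] at hnew
        rw [hnew]
        rcases Nat.eq_zero_or_pos m with h0 | hpos
        · rw [h0]; rfl
        · have hU := hch (0, true)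
          have hD := hch (0, false)
          rw [hn, nxt_of_lt hpos] at hU hD
          rw [hU, hD, sumTo_congr (g := fun i => fastS B j (updF (st updF s₀ w) (i + 1, true)) m +
              fastS B j (updF (st updF s₀ w) (i + 1, false)) m) (fun i hi => by
            have hp := hch (i + 1, true)
            have hq := hch (i + 1, false)
            rw [hn, nxt_of_lt (by omega)] at hp hq
            rw [hp, hq])]

/-- ★★★ THE ROOT VALUE FROM THE TABLE: with a true table, `fastS B L (s0F tr L) 0 = fastVT T B (s0F tr L) L [] 0` — the right-hand side
is a small kernel evaluation once the table covers the search below some depth. [cite: MadrasSlade1993, Definition 1.2.4] -/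
theorem fastS_root_eq_fastVT (T : List (List (ℕ × Bool) × ℕ × ℕ × List ℕ)) (B : ℕ) (tr : Tri) (L : ℕ)
    (hT : ∀ e ∈ T, e.1.length + e.2.1 = L ∧ naxL 0 e.1 = e.2.2.1 ∧ fastS B e.2.1 (st updF (s0F tr L) e.1) e.2.2.1 = Nat.ofDigits B e.2.2.2) :
    fastS B L (s0F tr L) 0 = fastVT T B (s0F tr L) L [] 0 := by
  have h := fastVT_eq T B (s0F tr L) L hT L [] (by simp)
  exact h.symm

/-- Splitting a table hypothesis over a concatenation. [cite: MadrasSlade1993, Definition 1.2.4] -/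
theorem forall_mem_append_of {α : Type*} {P : α → Prop} {l₁ l₂ : List α} (h₁ : ∀ e ∈ l₁, P e) (h₂ : ∀ e ∈ l₂, P e) :
    ∀ e ∈ l₁ ++ l₂, P e := fun e he => (List.mem_append.1 he).elim (h₁ e) (h₂ e)

/-- A table hypothesis from its shape check (lengths and axis counts, decidable) and the cell theorems. [cite: MadrasSlade1993, Definition 1.2.4] -/
theorem table_ok_of {T : List (List (ℕ × Bool) × ℕ × ℕ × List ℕ)} {B : ℕ} {s₀ : FS} {L : ℕ}
    (hshape : (T.all fun e => e.1.length + e.2.1 == L && naxL 0 e.1 == e.2.2.1) = true)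
    (hcells : ∀ e ∈ T, fastS B e.2.1 (st updF s₀ e.1) e.2.2.1 = Nat.ofDigits B e.2.2.2) :
    ∀ e ∈ T, e.1.length + e.2.1 = L ∧ naxL 0 e.1 = e.2.2.1 ∧ fastS B e.2.1 (st updF s₀ e.1) e.2.2.1 = Nat.ofDigits B e.2.2.2 := by
  intro e he
  have h := List.all_eq_true.1 hshape e he
  simp only [Bool.and_eq_true, beq_iff_eq] at h
  exact ⟨h.1, h.2, hcells e he⟩

end assembly

/-! ### §5 Self-test against the landed cell `N_{9,12}`

The lean engine run on the certified trie `tr9_12` of `…ZdBridgeSearch` returns, as ONE kernel evaluation of the whole cell (28 860 live search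
nodes), the reduced table `[0, 0, 135, 4081, 5806, 1538, 91, 0, …]` of `…ZdBridgeNineTwelve` (there: three cells of the reversed-prefix engine). -/

section selftest

set_option maxHeartbeats 4000000 in
/-- ★ SELF-TEST: the lean census value of `N_{9,12}` in base `2^64` is the landed table `tab9_12` of `…ZdBridgeNineTwelve` (by total number of axes).
[cite: MadrasSlade1993, §4.2, eq. (4.2.20)–(4.2.22) (p. 94, 2013 reprint)] -/
theorem fastS_tr9_12_root : fastS 18446744073709551616 12 (s0F tr9_12 12) 0 =
    Nat.ofDigits 18446744073709551616 [0, 0, 135, 4081, 5806, 1538, 91, 0, 0, 0, 0, 0, 0] := by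
  decide +kernel

/-- The self-test read in every dimension: the lean engine re-derives `N_{9,12}(ℤ^{d+1})` in falling factorials (cf. `costCoeffZd_nine_twelve_descFactorial`).
[cite: MadrasSlade1993, §4.2, eq. (4.2.20)–(4.2.22) (p. 94, 2013 reprint)] -/
theorem costCoeffZd_nine_twelve_eq_sum_fast (d : ℕ) : costCoeffZd d 9 12 =
    ∑ k ∈ Finset.range 12, 2 ^ k * [0, 0, 135, 4081, 5806, 1538, 91, 0, 0, 0, 0, 0, 0].getD (k + 1) 0 * d.descFactorial k :=
  costCoeffZd_eq_sum_of_fastS d 9 11 tr9_12 patOK_tr9_12 inTrie_tr9_12_nil (by norm_num) 18446744073709551616 (by norm_num) _ rfl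
    (by decide) rfl fastS_tr9_12_root

end selftest

end WordTypes

end Literature.Probability.RandomPlanarGeometry.SAW.Zd
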